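/-
Copyright (c) 2026. All rights reserved.
Released under Apache 2.0 license as described in the file LICENSE.
Authors: abc-iut cell, prover seat abc-iut-w5-d144 (gen 6; row «COR510iv-SB′», brick A), after abc-iut-f-101's
`DiagramChainFamilies.lean` (the one-sided case of a sink vertex).
-/
import Literature.AnabelianGeometry.AbsoluteAnabelian.DiagramChainFamilies

/-!
# Families of homotopies generated by TWO-SIDED whiskered generator pairs ([AbsTopIII] Def. 3.5 (ii), toolkit)

S. Mochizuki, *Topics in Absolute Anabelian Geometry III*, §0 p. 26 (saturated sets of co-verticial pairs: diagonal,
transitivity, pre- and post-composition) and Def. 3.5 (ii) p. 75 (families of homotopies: identity, composition,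
whiskering), kurims manuscript `paper:url-5493eb38cbb7`, bib key `MochizukiAbsTopIII2015`.

abc-iut-f-101's `DiagramChainFamilies.chainFamily` builds the family of homotopies GENERATED by prescribed homotopies on
prescribed generator pairs, for pairs of paths into a SINK vertex `ω` (no outgoing edge — the observation vertex of an
observable), where post-composition is vacuous.  The compatibility statements of [AbsTopIII] Cor 5.5 (iii) / Cor 5.10
(iv)(b) («one family on the telecore diagram containing the telecore family AND the observables») need the same
constructor WITHOUT a sink: generator pairs whiskered on BOTH sides, boundary pairs ending at any vertex.  This file:

* `moveHom₂ r α t` — the homotopy `𝒟_[r ; g ; t] ⟶ 𝒟_[r ; g' ; t]` induced by `α : 𝒟_[g] ⟶ 𝒟_[g']` (third axiom of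
  Def. 3.5 (ii)), `moveHom₂_app`;
* `Move₂` (a generator pair with a common prefix `r` AND a common suffix `t`), `Chain₂`, their homotopies, `append`,
  `shift` (longer prefix), `postShift` (longer suffix), and the laws `hom_append`, `hom_shift_app`,
  `hom_postShift_app` (componentwise, plain objects);
* `chainFamily₂`: GIVEN COHERENCE (`thin`: any two chains between the same two paths have the same homotopy), the
  family of homotopies whose boundary set is "pairs joined by a chain of two-sided moves" (`ChainRel₂`, saturated under
  all four moves of §0: `chainRel₂_isSaturated`) and whose homotopy on a pair is that of any chain (`chainFamily₂_η`);
  a generator pair carries its prescribed homotopy (`chainFamily₂_η_gen`).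

Coherence is exactly what a consumer must supply.  Pure category theory; plumbing is `[folklore]`, the statements cite
the item of §0 / Def. 3.5 whose bookkeeping they are.  Nothing here bears on [IUTchIII] Cor. 3.12.
-/

namespace Literature.AnabelianGeometry.AbsoluteAnabelian

open _root_.CategoryTheory _root_.Quiver

universe t v u w

namespace DiagramOfCategories

variable {V : Type w} [Quiver.{v} V] (D : DiagramOfCategories.{v, u, w} V)

/-! ## Bookkeeping -/

/-- Transport of a component of a natural transformation along an equality of objects. [folklore] -/
private theorem app_congr_obj₂ {A B : Type*} [Category A] [Category B] {F G : A ⥤ B} (α : F ⟶ G) {y y' : A}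
    (hy : y = y') : α.app y = eqToHom (by rw [hy]) ≫ α.app y' ≫ eqToHom (by rw [hy]) := by
  subst hy
  simp

/-- The path functor of a path presented as a two-sided composite. [cite: MochizukiAbsTopIII2015, Definition 3.5 (i) p.75] -/
theorem pathFunctor_eq_of_eq_comp₂ {a c d b : V} {p : Path a b} (r : Path a c) (g : Path c d) (t : Path d b)
    (hp : p = (r.comp g).comp t) : D.pathFunctor p = D.pathFunctor r ⋙ D.pathFunctor g ⋙ D.pathFunctor t := by
  rw [hp, pathFunctor_comp, pathFunctor_comp]; rfl

/-- The same on objects, with plain objects. [cite: MochizukiAbsTopIII2015, Definition 3.5 (i) p.75] -/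
theorem pathFunctor_obj_of_eq_comp₂ {a c d b : V} {p : Path a b} (r : Path a c) (g : Path c d) (t : Path d b)
    (hp : p = (r.comp g).comp t) (x : D.obj a) :
    (D.pathFunctor p).obj x = (D.pathFunctor t).obj ((D.pathFunctor g).obj ((D.pathFunctor r).obj x)) := by
  rw [hp, pathFunctor_comp, pathFunctor_comp]; rfl

/-! ## The homotopy of a two-sided whiskered generator pair ("move") -/

/-- The homotopy `𝒟_[r ; g ; t] ⟶ 𝒟_[r ; g' ; t]` induced by a homotopy `α : 𝒟_[g] ⟶ 𝒟_[g']` of a co-verticial pair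
`(g, g')` preceded by a common path `r` and followed by a common path `t` (Def. 3.5 (ii), third axiom), on paths
`p = t ∘ g ∘ r`, `p' = t ∘ g' ∘ r` given by equations. [cite: MochizukiAbsTopIII2015, Definition 3.5 (ii) p.75] -/
noncomputable def moveHom₂ {a c d b : V} (r : Path a c) {g g' : Path c d} (α : D.pathFunctor g ⟶ D.pathFunctor g')
    (t : Path d b) {p p' : Path a b} (hp : p = (r.comp g).comp t) (hp' : p' = (r.comp g').comp t) :
    D.pathFunctor p ⟶ D.pathFunctor p' :=
  eqToHom (D.pathFunctor_eq_of_eq_comp₂ r g t hp) ≫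
    Functor.whiskerLeft (D.pathFunctor r) (Functor.whiskerRight α (D.pathFunctor t)) ≫
    eqToHom (D.pathFunctor_eq_of_eq_comp₂ r g' t hp').symm

/-- Components of `moveHom₂` (plain objects). [cite: MochizukiAbsTopIII2015, Definition 3.5 (ii) p.75] -/
theorem moveHom₂_app {a c d b : V} (r : Path a c) {g g' : Path c d} (α : D.pathFunctor g ⟶ D.pathFunctor g')
    (t : Path d b) {p p' : Path a b} (hp : p = (r.comp g).comp t) (hp' : p' = (r.comp g').comp t) (x : D.obj a) :
    (D.moveHom₂ r α t hp hp').app x =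
      eqToHom (D.pathFunctor_obj_of_eq_comp₂ r g t hp x) ≫
        (D.pathFunctor t).map (α.app ((D.pathFunctor r).obj x)) ≫
        eqToHom (D.pathFunctor_obj_of_eq_comp₂ r g' t hp' x).symm := by
  rw [moveHom₂, app_eqToHom_whisker]

variable (Gen : ∀ ⦃c d : V⦄, Path c d → Path c d → Type t)
  (genHom : ∀ ⦃c d : V⦄ ⦃g g' : Path c d⦄, Gen g g' → (D.pathFunctor g ⟶ D.pathFunctor g'))

/-- A **two-sided move** from `p` to `p'`: a generator pair `(g, g')` preceded by a common path `r` and followed by a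
common path `t` — `p = t ∘ g ∘ r`, `p' = t ∘ g' ∘ r` (the pre- and post-composition clauses (d), (e) of a saturated set,
§0 p. 26, applied to a generator). [cite: MochizukiAbsTopIII2015, Section 0 p.26] -/
structure Move₂ {a b : V} (p p' : Path a b) : Type (max t v w) where
  /-- the vertex where the generator pair starts -/
  c : V
  /-- the vertex where the generator pair ends -/
  d : V
  /-- the common prefix -/
  r : Path a c
  /-- the generator pair -/
  g : Path c d
  /-- the generator pair -/
  g' : Path c d
  /-- the common suffix -/
  t : Path d b
  /-- the generator -/
  s : Gen g g'
  hp : p = (r.comp g).comp t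
  hp' : p' = (r.comp g').comp t

namespace Move₂

variable {D Gen}

/-- The homotopy of a two-sided move: the generator's homotopy whiskered with `𝒟_[r]` and `𝒟_[t]`.
[cite: MochizukiAbsTopIII2015, Definition 3.5 (ii) p.75] -/
noncomputable def hom {a b : V} {p p' : Path a b} (m : Move₂ Gen p p') : D.pathFunctor p ⟶ D.pathFunctor p' :=
  D.moveHom₂ m.r (genHom m.s) m.t m.hp m.hp'

/-- A move preceded by a further common path. [cite: MochizukiAbsTopIII2015, Section 0 p.26] -/
def shift {a' a b : V} {p p' : Path a b} (r₁ : Path a' a) (m : Move₂ Gen p p') :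
    Move₂ Gen (r₁.comp p) (r₁.comp p') :=
  ⟨m.c, m.d, r₁.comp m.r, m.g, m.g', m.t, m.s,
    (congrArg (fun q => r₁.comp q) m.hp).trans (by simp only [Path.comp_assoc]),
    (congrArg (fun q => r₁.comp q) m.hp').trans (by simp only [Path.comp_assoc])⟩

/-- A move followed by a further common path. [cite: MochizukiAbsTopIII2015, Section 0 p.26] -/
def postShift {a b b' : V} {p p' : Path a b} (m : Move₂ Gen p p') (t₁ : Path b b') :
    Move₂ Gen (p.comp t₁) (p'.comp t₁) :=
  ⟨m.c, m.d, m.r, m.g, m.g', m.t.comp t₁, m.s,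
    (congrArg (fun q => q.comp t₁) m.hp).trans (by simp only [Path.comp_assoc]),
    (congrArg (fun q => q.comp t₁) m.hp').trans (by simp only [Path.comp_assoc])⟩

/-- The homotopy of a shifted move is the left-whiskered homotopy, componentwise.
[cite: MochizukiAbsTopIII2015, Definition 3.5 (ii) p.75] -/
theorem shift_hom_app {a' a b : V} {p p' : Path a b} (r₁ : Path a' a) (m : Move₂ Gen p p') (x : D.obj a') :
    ((m.shift r₁).hom genHom).app x =
      eqToHom (D.pathFunctor_comp_obj r₁ p x) ≫ (m.hom genHom).app ((D.pathFunctor r₁).obj x) ≫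
        eqToHom (D.pathFunctor_comp_obj r₁ p' x).symm := by
  simp only [hom, shift]
  rw [moveHom₂_app, moveHom₂_app, app_congr_obj₂ (genHom m.s) (D.pathFunctor_comp_obj r₁ m.r x)]
  simp only [Functor.map_comp, eqToHom_map, Category.assoc, eqToHom_trans, eqToHom_trans_assoc]

/-- The homotopy of a post-shifted move is the right-whiskered homotopy, componentwise.
[cite: MochizukiAbsTopIII2015, Definition 3.5 (ii) p.75] -/
theorem postShift_hom_app {a b b' : V} {p p' : Path a b} (m : Move₂ Gen p p') (t₁ : Path b b') (x : D.obj a) :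
    ((m.postShift t₁).hom genHom).app x =
      eqToHom (D.pathFunctor_comp_obj p t₁ x) ≫ (D.pathFunctor t₁).map ((m.hom genHom).app x) ≫
        eqToHom (D.pathFunctor_comp_obj p' t₁ x).symm := by
  simp only [hom, postShift]
  rw [moveHom₂_app, moveHom₂_app, D.pathFunctor_comp_map m.t t₁]
  simp only [Functor.map_comp, eqToHom_map, Category.assoc, eqToHom_trans, eqToHom_trans_assoc]

end Move₂

/-! ## Chains of two-sided moves and their homotopies -/

/-- A **chain** of two-sided moves from `p` to `q` (the transitive closure, §0 p. 26 (c)).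
[cite: MochizukiAbsTopIII2015, Section 0 p.26] -/
inductive Chain₂ : ∀ {a b : V}, Path a b → Path a b → Type (max t v w)
  | nil {a b : V} (p : Path a b) : Chain₂ p p
  | cons {a b : V} {p p' q : Path a b} (m : Move₂ Gen p p') (rest : Chain₂ p' q) : Chain₂ p q

namespace Chain₂

variable {D Gen}

/-- The homotopy of a chain: the composite of the homotopies of its moves (Def. 3.5 (ii), second axiom).
[cite: MochizukiAbsTopIII2015, Definition 3.5 (ii) p.75] -/
noncomputable def hom : ∀ {a b : V} {p q : Path a b}, Chain₂ Gen p q → (D.pathFunctor p ⟶ D.pathFunctor q)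
  | _, _, _, _, nil p => 𝟙 _
  | _, _, _, _, cons m rest => m.hom genHom ≫ rest.hom

/-- Concatenation of chains. [cite: MochizukiAbsTopIII2015, Section 0 p.26] -/
def append : ∀ {a b : V} {p q s : Path a b}, Chain₂ Gen p q → Chain₂ Gen q s → Chain₂ Gen p s
  | _, _, _, _, _, nil _, c' => c'
  | _, _, _, _, _, cons m rest, c' => cons m (rest.append c')

/-- A chain preceded by a common path. [cite: MochizukiAbsTopIII2015, Section 0 p.26] -/
def shift {a' a : V} (r₁ : Path a' a) : ∀ {b : V} {p q : Path a b}, Chain₂ Gen p q →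
    Chain₂ Gen (r₁.comp p) (r₁.comp q)
  | _, _, _, nil p => nil (r₁.comp p)
  | _, _, _, cons m rest => cons (m.shift r₁) (rest.shift r₁)

/-- A chain followed by a common path. [cite: MochizukiAbsTopIII2015, Section 0 p.26] -/
def postShift : ∀ {a b : V} {p q : Path a b}, Chain₂ Gen p q → ∀ {b' : V} (t₁ : Path b b'),
    Chain₂ Gen (p.comp t₁) (q.comp t₁)
  | _, _, _, _, nil p, _, t₁ => nil (p.comp t₁)
  | _, _, _, _, cons m rest, _, t₁ => cons (m.postShift t₁) (rest.postShift t₁)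

/-- The homotopy of the empty chain (by definition; kept file-local — same shape as the one-sided `Chain.hom_nil`). [folklore] -/
@[simp] private theorem hom_nil {a b : V} (p : Path a b) : (nil (Gen := Gen) p).hom genHom = 𝟙 (D.pathFunctor p) := by
  rw [hom]

/-- The homotopy of a chain with a first move. [cite: MochizukiAbsTopIII2015, Definition 3.5 (ii) p.75] -/
@[simp] theorem hom_cons {a b : V} {p p' q : Path a b} (m : Move₂ Gen p p') (rest : Chain₂ Gen p' q) :
    (cons m rest).hom genHom = m.hom genHom ≫ rest.hom genHom := by
  rw [hom]

/-- The homotopy of a concatenation is the composite. [cite: MochizukiAbsTopIII2015, Definition 3.5 (ii) p.75] -/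
theorem hom_append : ∀ {a b : V} {p q s : Path a b} (c : Chain₂ Gen p q) (c' : Chain₂ Gen q s),
    (c.append c').hom genHom = c.hom genHom ≫ c'.hom genHom
  | _, _, _, _, _, nil _, c' => by rw [append, hom_nil, Category.id_comp]
  | _, _, _, _, _, cons m rest, c' => by
    rw [append, hom_cons, hom_cons, hom_append rest c', Category.assoc]

/-- The homotopy of a shifted chain is the left-whiskered homotopy, componentwise (Def. 3.5 (ii), third axiom).
[cite: MochizukiAbsTopIII2015, Definition 3.5 (ii) p.75] -/
theorem hom_shift_app {a' a : V} (r₁ : Path a' a) : ∀ {b : V} {p q : Path a b} (c : Chain₂ Gen p q) (x : D.obj a'),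
    ((c.shift r₁).hom genHom).app x =
      eqToHom (D.pathFunctor_comp_obj r₁ p x) ≫ (c.hom genHom).app ((D.pathFunctor r₁).obj x) ≫
        eqToHom (D.pathFunctor_comp_obj r₁ q x).symm
  | _, _, _, nil p, x => by
    rw [shift, hom_nil, hom_nil, NatTrans.id_app, NatTrans.id_app, Category.id_comp, eqToHom_trans, eqToHom_refl]
  | _, _, _, cons m rest, x => by
    rw [shift, hom_cons, hom_cons, NatTrans.comp_app, NatTrans.comp_app, Move₂.shift_hom_app,
      hom_shift_app r₁ rest x]
    simp only [Category.assoc, eqToHom_trans_assoc, eqToHom_refl, Category.id_comp]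

/-- The homotopy of a post-shifted chain is the right-whiskered homotopy, componentwise (Def. 3.5 (ii), third axiom).
[cite: MochizukiAbsTopIII2015, Definition 3.5 (ii) p.75] -/
theorem hom_postShift_app : ∀ {a b : V} {p q : Path a b} (c : Chain₂ Gen p q) {b' : V} (t₁ : Path b b')
    (x : D.obj a),
    ((c.postShift t₁).hom genHom).app x =
      eqToHom (D.pathFunctor_comp_obj p t₁ x) ≫ (D.pathFunctor t₁).map ((c.hom genHom).app x) ≫
        eqToHom (D.pathFunctor_comp_obj q t₁ x).symm
  | _, _, _, _, nil p, _, t₁, x => by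
    rw [postShift, hom_nil, hom_nil, NatTrans.id_app, NatTrans.id_app, Functor.map_id, Category.id_comp,
      eqToHom_trans, eqToHom_refl]
  | _, _, _, _, cons m rest, _, t₁, x => by
    rw [postShift, hom_cons, hom_cons, NatTrans.comp_app, NatTrans.comp_app, Move₂.postShift_hom_app,
      hom_postShift_app rest t₁ x, Functor.map_comp]
    simp only [Category.assoc, eqToHom_trans_assoc, eqToHom_refl, Category.id_comp]

end Chain₂

/-! ## The family of homotopies generated by the two-sided moves -/

section Family

variable (thin : ∀ {a b : V} (p q : Path a b) (c c' : Chain₂ Gen p q), c.hom genHom = c'.hom genHom)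

/-- The boundary set: pairs of co-verticial paths joined by a chain of two-sided moves (§0 p. 26: the saturation of
the generator pairs). [cite: MochizukiAbsTopIII2015, Section 0 p.27] -/
def ChainRel₂ ⦃a b : V⦄ (p q : Path a b) : Prop := Nonempty (Chain₂ Gen p q)

/-- It is saturated (diagonal, transitivity by concatenation, pre-composition by `shift`, post-composition by
`postShift`). [cite: MochizukiAbsTopIII2015, Section 0 p.26] -/
theorem chainRel₂_isSaturated : IsSaturated (ChainRel₂ Gen (V := V)) where
  refl_left _ _ p _ _ := ⟨Chain₂.nil p⟩
  refl_right _ _ _ q _ := ⟨Chain₂.nil q⟩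
  trans _ _ _ _ _ h₁ h₂ := ⟨h₁.some.append h₂.some⟩
  precomp _ _ _ _ _ h r := ⟨h.some.shift r⟩
  postcomp _ _ _ _ _ h r := ⟨h.some.postShift r⟩

include thin in
/-- The homotopy attached to a boundary pair is that of ANY chain joining it. [cite: MochizukiAbsTopIII2015, Definition 3.5 (ii) p.75] -/
private theorem hom_some_eq₂ {a b : V} {p q : Path a b} (h : ChainRel₂ Gen p q) (c : Chain₂ Gen p q) :
    Chain₂.hom genHom h.some = c.hom genHom :=
  thin _ _ _ _

include thin in
/-- **The family of homotopies generated by the two-sided moves** (Def. 3.5 (ii)): boundary set = pairs joined by a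
chain of moves, homotopy = the composite along ANY chain — well defined by the coherence hypothesis `thin` (any two
chains between the same pair of paths have the same homotopy); identity on the diagonal, composition and two-sided
whiskering then hold by construction. [cite: MochizukiAbsTopIII2015, Definition 3.5 (ii) p.75] -/
noncomputable def chainFamily₂ : D.HomotopyFamily where
  E := ChainRel₂ Gen
  isSaturated := chainRel₂_isSaturated Gen
  η := fun _ _ _ _ h => Chain₂.hom genHom h.some
  η_refl := by
    intro a b p h
    exact (hom_some_eq₂ D Gen genHom thin h (Chain₂.nil p)).trans (Chain₂.hom_nil genHom p)
  η_trans := by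
    intro a b p q r h₁ h₂
    exact (hom_some_eq₂ D Gen genHom thin ((chainRel₂_isSaturated Gen).trans h₁ h₂)
      (h₁.some.append h₂.some)).trans (Chain₂.hom_append genHom _ _)
  η_whisker := by
    intro a b c d p q h r₁ r₂
    ext x
    refine (NatTrans.congr_app (hom_some_eq₂ D Gen genHom thin
      ((chainRel₂_isSaturated Gen).precomp ((chainRel₂_isSaturated Gen).postcomp h r₂) r₁)
      ((h.some.postShift r₂).shift r₁)) x).trans ?_
    rw [Chain₂.hom_shift_app, Chain₂.hom_postShift_app, app_eqToHom_whisker]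
    simp only [Category.assoc, eqToHom_trans, eqToHom_trans_assoc]

/-- The boundary set of the generated family. [cite: MochizukiAbsTopIII2015, Definition 3.5 (ii) p.75] -/
theorem chainFamily₂_E {a b : V} (p q : Path a b) :
    (chainFamily₂ D Gen genHom thin).E p q ↔ Nonempty (Chain₂ Gen p q) := Iff.rfl

/-- A chain of moves is a boundary pair. [cite: MochizukiAbsTopIII2015, Definition 3.5 (ii) p.75] -/
theorem chainFamily₂_mem {a b : V} {p q : Path a b} (c : Chain₂ Gen p q) :
    (chainFamily₂ D Gen genHom thin).E p q := ⟨c⟩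

/-- The homotopies of the generated family are computed by ANY chain.
[cite: MochizukiAbsTopIII2015, Definition 3.5 (ii) p.75] -/
theorem chainFamily₂_η {a b : V} {p q : Path a b} (h : (chainFamily₂ D Gen genHom thin).E p q)
    (c : Chain₂ Gen p q) : (chainFamily₂ D Gen genHom thin).η h = c.hom genHom :=
  thin _ _ _ _

/-- A single two-sided move is a boundary pair whose homotopy is the move's. [cite: MochizukiAbsTopIII2015, Definition 3.5 (ii) p.75] -/
theorem chainFamily₂_η_move {a b : V} {p p' : Path a b} (m : Move₂ Gen p p') :
    ∃ h : (chainFamily₂ D Gen genHom thin).E p p', (chainFamily₂ D Gen genHom thin).η h = m.hom genHom := by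
  refine ⟨chainFamily₂_mem D Gen genHom thin (Chain₂.cons m (Chain₂.nil p')), ?_⟩
  rw [chainFamily₂_η D Gen genHom thin _ (Chain₂.cons m (Chain₂.nil p')), Chain₂.hom_cons, Chain₂.hom_nil,
    Category.comp_id]

/-- In particular a single generator pair `(g, g')` is a boundary pair whose homotopy is the generator's, componentwise
(the casts are identities between the two ends of the defining equations `𝒟_[nil] = 𝟭`).
[cite: MochizukiAbsTopIII2015, Definition 3.5 (ii) p.75] -/
theorem chainFamily₂_η_gen {c d : V} {g g' : Path c d} (s : Gen g g') (x : D.obj c) :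
    ∃ (h : (chainFamily₂ D Gen genHom thin).E g g')
      (e : (D.pathFunctor g).obj x =
        (D.pathFunctor (Path.nil : Path d d)).obj ((D.pathFunctor g).obj ((D.pathFunctor (Path.nil : Path c c)).obj x)))
      (e' : (D.pathFunctor (Path.nil : Path d d)).obj ((D.pathFunctor g').obj ((D.pathFunctor (Path.nil : Path c c)).obj x)) =
        (D.pathFunctor g').obj x),
      ((chainFamily₂ D Gen genHom thin).η h).app x =
        eqToHom e ≫ (D.pathFunctor (Path.nil : Path d d)).map ((genHom s).app ((D.pathFunctor (Path.nil : Path c c)).obj x)) ≫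
          eqToHom e' := by
  let m : Move₂ Gen g g' := ⟨c, d, Path.nil, g, g', Path.nil, s,
    by rw [Path.nil_comp, Path.comp_nil], by rw [Path.nil_comp, Path.comp_nil]⟩
  obtain ⟨h, hη⟩ := chainFamily₂_η_move D Gen genHom thin m
  refine ⟨h, D.pathFunctor_obj_of_eq_comp₂ Path.nil g Path.nil m.hp x,
    (D.pathFunctor_obj_of_eq_comp₂ Path.nil g' Path.nil m.hp' x).symm, ?_⟩
  rw [hη]
  exact D.moveHom₂_app Path.nil (genHom s) Path.nil m.hp m.hp' x

end Family

end DiagramOfCategories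

end Literature.AnabelianGeometry.AbsoluteAnabelian
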